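import Summits.CriticalPhenomena.SAWScalingLimit.Theorems.SAWDevelopingMapObservableToSLETypeLadderCarvedReductionSqueezeLevelLimits
import HarnessLib

/-!
# Limits of pinned lattice hexagons GIVEN AS CELLS (piece (T-A lim-c) of stub T-A
# `stub_carvedReduction_squeezeGeometry`)

Crux `SAWDevelopingMap.ObservableToSLE` (stmt-CriticalPhenomena-10472), line `six-class-type-ladder`,
stub T-A `stub_carvedReduction_squeezeGeometry`.  Landing target:
`Summits/CriticalPhenomena/SAWScalingLimit/Theorems/SAWDevelopingMapObservableToSLETypeLadderCarvedReductionSqueezeCellLimits.lean`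
(`--supports stmt-CriticalPhenomena-10472`).  Refactoring of `…SqueezeLevelLimits` (p138622) for the
consumers that must TRACK the hexagons: `level_limits` chooses the cells from the list description of
the level and returns them opaquely; the construction of the super-domain needs the limits of
PRESCRIBED cells (the listed level hexagons together with the spine hexagons through their centres,
clause 2 of the fat-spine condition — the no-dangling structure).  This file states the same limit
theorem for a given family of cells `g j i` (`i : Fin N`), each hexagon `R`-local about the root:
`cells_limits` (convergence of pinned centres and radii along a subsequence, persistence,
containment, eventual carving of compacts), and the padding of a list description into cells,
`exists_cells_of_list` (registered as `stub_carvedReduction_cellsOfList`).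
-/

noncomputable section

open scoped Topology
open Filter Set Metric
open Literature.Probability.LatticeModels (HexVertex hexGraph hexCenter triZeta triEmbed Site)
open Literature.Probability.RandomPlanarGeometry
open Literature.Probability.Percolation (norm_triZeta)

namespace Summit.CriticalPhenomena.SAWScalingLimit.Theorems.ObservableToSLE.TypeLadder

open Summit.CriticalPhenomena.SAWScalingLimit.Theorems.ObservableToSLER.BridgeGate

/-! ### Cells from a list description -/

/-- **Padding a list description into `N` cells.**  If `L` is described by a list of at most `N`
hexagons and contains `root`, there are `N` cells whose hexagons are exactly `L`, each being a listed
hexagon or the trivial hexagon `{root}`; listed hexagons appear at their list index. -/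
theorem exists_cells_of_list {N : ℕ} {L : Set HexVertex} {root : HexVertex} {Lst : List (HexVertex × ℕ)}
    (hlen : Lst.length ≤ N) (hLst : ∀ v : HexVertex, v ∈ L ↔ ∃ tk ∈ Lst, v ∈ hexBall tk.1 tk.2)
    (hroot : root ∈ L) :
    ∃ g : Fin N → HexVertex × ℕ,
      (∀ v : HexVertex, v ∈ L ↔ ∃ i, v ∈ hexBall (g i).1 (g i).2) ∧
      (∀ i, g i ∈ Lst ∨ g i = (root, 0)) ∧ (∀ i, hexBall (g i).1 (g i).2 ⊆ L) ∧
      (∀ (m : ℕ) (hm : m < Lst.length), g ⟨m, lt_of_lt_of_le hm hlen⟩ = Lst[m]) := by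
  classical
  set g : Fin N → HexVertex × ℕ := fun i => Lst.getD i (root, 0) with hg
  have hgmem : ∀ i, g i ∈ Lst ∨ g i = (root, 0) := by
    intro i
    by_cases h : (i : ℕ) < Lst.length
    · left; rw [hg]; simp only; rw [List.getD_eq_getElem _ _ h]; exact List.getElem_mem h
    · right; rw [hg]; simp only; rw [List.getD_eq_default _ _ (not_lt.1 h)]
  have hgsub : ∀ i, hexBall (g i).1 (g i).2 ⊆ L := by
    intro i v hv
    rcases hgmem i with h | h
    · exact (hLst v).2 ⟨_, h, hv⟩
    · rw [h] at hv
      rw [(mem_hexBall_zero_iff _ _).1 hv]; exact hroot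
  refine ⟨g, fun v => ⟨fun hv => ?_, ?_⟩, hgmem, hgsub, fun m hm => ?_⟩
  · obtain ⟨tk, htk, hvtk⟩ := (hLst v).1 hv
    obtain ⟨m, hm, rfl⟩ := List.getElem_of_mem htk
    refine ⟨⟨m, lt_of_lt_of_le hm hlen⟩, ?_⟩
    rw [hg]; simp only; rw [List.getD_eq_getElem _ _ hm]; exact hvtk
  · rintro ⟨i, hi⟩; exact hgsub i hi
  · rw [hg]; simp only; rw [List.getD_eq_getElem _ _ hm]

/-- **Registered sub-goal `stub_carvedReduction_cellsOfList`** (crux item stmt-CriticalPhenomena-10472,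
stub T-A `stub_carvedReduction_squeezeGeometry`, piece (T-A lim-c)): registry form of
`exists_cells_of_list` (without the index clause). -/
theorem stub_carvedReduction_cellsOfList :
    ∀ (N : ℕ) (L : Set HexVertex) (root : HexVertex) (Lst : List (HexVertex × ℕ)), Lst.length ≤ N →
      (∀ v : HexVertex, v ∈ L ↔ ∃ tk ∈ Lst, v ∈ hexBall tk.1 tk.2) → root ∈ L →
      ∃ g : Fin N → HexVertex × ℕ, (∀ v : HexVertex, v ∈ L ↔ ∃ i, v ∈ hexBall (g i).1 (g i).2) ∧
        (∀ i, g i ∈ Lst ∨ g i = (root, 0)) ∧ (∀ i, hexBall (g i).1 (g i).2 ⊆ L) := by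
  intro N L root Lst hlen hLst hroot
  obtain ⟨g, h1, h2, h3, -⟩ := exists_cells_of_list hlen hLst hroot
  exact ⟨g, h1, h2, h3⟩

/-! ### The limits of prescribed cells -/

/-- **LIMITS OF PRESCRIBED PINNED CELLS**: `cells_limits`.  Cells `g j i` (`i : Fin N`) whose
hexagons are `R`-local about `root j` at mesh `s j > 0`, `s j → 0`, pinned roots
`s_j c_{root j} - τ j → ℓ₀`.  Along a subsequence `ψ` the pinned centres converge to `C i` and the
pinned radii `s (r + 1/2)` to `ϱ i ≥ 0`, with persistence, containment and eventual carving of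
compacts, hexagon by hexagon. -/
theorem cells_limits {N : ℕ} {s : ℕ → ℝ} {τ : ℕ → ℂ} {g : ℕ → Fin N → HexVertex × ℕ} {root : ℕ → HexVertex}
    {R : ℝ} {ℓ₀ : ℂ} (hspos : ∀ j, 0 < s j) (hs0 : Tendsto s atTop (𝓝 0))
    (hloc : ∀ j i, ∀ v ∈ hexBall (g j i).1 (g j i).2,
      dist ((s j : ℂ) * hexCenter v) ((s j : ℂ) * hexCenter (root j)) ≤ R)
    (hrootlim : Tendsto (fun j => (s j : ℂ) * hexCenter (root j) - τ j) atTop (𝓝 ℓ₀)) :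
    ∃ (ψ : ℕ → ℕ) (C : Fin N → ℂ) (ϱ : Fin N → ℝ),
      StrictMono ψ ∧ (∀ i, 0 ≤ ϱ i) ∧ (∀ i, dist (C i) ℓ₀ ≤ R) ∧
      (∀ i, Tendsto (fun j => (s (ψ j) : ℂ) * hexCenter (g (ψ j) i).1 - τ (ψ j)) atTop (𝓝 (C i))) ∧
      (∀ i, Tendsto (fun j => s (ψ j) * ((g (ψ j) i).2 + 1 / 2)) atTop (𝓝 (ϱ i))) ∧
      (∀ ε > (0 : ℝ), ∀ᶠ j in atTop, ∀ (i : Fin N) (v : HexVertex),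
        (∀ ℓ : Fin 3, |skewCoord ℓ ((s (ψ j) : ℂ) * hexCenter v - τ (ψ j) - C i)| ≤ ϱ i - ε) →
          v ∈ hexBall (g (ψ j) i).1 (g (ψ j) i).2) ∧
      (∀ ε > (0 : ℝ), ∀ᶠ j in atTop, ∀ (i : Fin N), ∀ v ∈ hexBall (g (ψ j) i).1 (g (ψ j) i).2,
        ∀ ℓ : Fin 3, |skewCoord ℓ ((s (ψ j) : ℂ) * hexCenter v - τ (ψ j) - C i)| ≤ ϱ i + ε) ∧
      (∀ K : Set ℂ, IsCompact K → (∀ i, Disjoint K {z : ℂ | ∀ ℓ : Fin 3, |skewCoord ℓ (z - C i)| ≤ ϱ i}) →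
        ∀ᶠ j in atTop, ∀ (i : Fin N), ∀ v ∈ hexBall (g (ψ j) i).1 (g (ψ j) i).2,
          (s (ψ j) : ℂ) * hexCenter v - τ (ψ j) ∉ K) := by
  classical
  -- pinned centres and radii
  set Ck : ℕ → Fin N → ℂ := fun j i => (s j : ℂ) * hexCenter (g j i).1 - τ j with hCk
  set ϱk : ℕ → Fin N → ℝ := fun j i => s j * ((g j i).2 + 1 / 2) with hϱk
  -- bounds
  have hCbd : ∀ j i, dist (Ck j i) ((s j : ℂ) * hexCenter (root j) - τ j) ≤ R := by
    intro j i
    rw [hCk]; simp only; rw [dist_sub_right]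
    exact hloc j i _ (mem_hexBall_self _ _)
  have hϱbd : ∀ j i, 0 ≤ ϱk j i ∧ ϱk j i ≤ 2 * R + s j := by
    intro j i
    refine ⟨mul_nonneg (hspos j).le (by positivity), ?_⟩
    obtain ⟨hmem, hctr⟩ := shift_mem_hexBall (g j i).1 (g j i).2
    have h1 := hloc j i _ hmem
    have h2 := hloc j i _ (mem_hexBall_self _ _)
    have h3 : dist ((s j : ℂ) * hexCenter (((g j i).1.1 + Pi.single 1 ((g j i).2 : ℤ), (g j i).1.2) : HexVertex))
        ((s j : ℂ) * hexCenter (g j i).1) = s j * (g j i).2 := by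
      rw [hctr, dist_eq_norm, mul_add, add_sub_cancel_left, norm_mul, norm_mul, Complex.norm_real,
        Complex.norm_natCast, norm_triZeta, mul_one, Real.norm_of_nonneg (hspos j).le]
    have h4 := dist_triangle ((s j : ℂ) * hexCenter (((g j i).1.1 + Pi.single 1 ((g j i).2 : ℤ), (g j i).1.2) : HexVertex))
      ((s j : ℂ) * hexCenter (root j)) ((s j : ℂ) * hexCenter (g j i).1)
    rw [dist_comm ((s j : ℂ) * hexCenter (root j))] at h4
    rw [hϱk]; simp only
    nlinarith [hspos j]
  -- the root sequence and the meshes are bounded eventually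
  have hrootbd : ∀ᶠ j in atTop, dist ((s j : ℂ) * hexCenter (root j) - τ j) ℓ₀ < 1 :=
    (tendsto_iff_dist_tendsto_zero.1 hrootlim).eventually (gt_mem_nhds one_pos)
  have hsbd : ∀ᶠ j in atTop, s j < 1 := (tendsto_order.1 hs0).2 1 one_pos
  -- Bolzano–Weierstrass in the product
  set P : ℕ → (Fin N → ℂ) × (Fin N → ℝ) := fun j => (Ck j, ϱk j) with hP
  set p₀ : (Fin N → ℂ) × (Fin N → ℝ) := (fun _ => ℓ₀, fun _ => 0) with hp₀
  have hPbd : ∀ᶠ j in atTop, P j ∈ closedBall p₀ (2 * |R| + 2) := by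
    filter_upwards [hrootbd, hsbd] with j hj hsj
    rw [mem_closedBall, Prod.dist_eq, max_le_iff]
    have hRabs : R ≤ |R| := le_abs_self R
    constructor
    · refine (dist_pi_le_iff (by positivity)).2 fun i => ?_
      calc dist (Ck j i) ℓ₀ ≤ dist (Ck j i) ((s j : ℂ) * hexCenter (root j) - τ j) +
            dist ((s j : ℂ) * hexCenter (root j) - τ j) ℓ₀ := dist_triangle _ _ _
        _ ≤ 2 * |R| + 2 := by linarith [hCbd j i, abs_nonneg R]
    · refine (dist_pi_le_iff (by positivity)).2 fun i => ?_
      rw [Real.dist_eq, sub_zero, abs_of_nonneg (hϱbd j i).1]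
      linarith [(hϱbd j i).2, abs_nonneg R]
  obtain ⟨p, -, ψ, hψ, hlim⟩ := tendsto_subseq_of_frequently_bounded
    (isBounded_closedBall (x := p₀) (r := 2 * |R| + 2)) hPbd.frequently
  -- coordinate limits
  have hClim : ∀ i, Tendsto (fun j => Ck (ψ j) i) atTop (𝓝 (p.1 i)) := fun i =>
    ((continuous_apply i).comp continuous_fst).continuousAt.tendsto.comp hlim
  have hϱlim : ∀ i, Tendsto (fun j => ϱk (ψ j) i) atTop (𝓝 (p.2 i)) := fun i =>
    ((continuous_apply i).comp continuous_snd).continuousAt.tendsto.comp hlim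
  have hsψ : Tendsto (fun j => s (ψ j)) atTop (𝓝 0) := hs0.comp hψ.tendsto_atTop
  have hϱnn : ∀ i, 0 ≤ p.2 i := fun i =>
    ge_of_tendsto' (hϱlim i) fun j => (hϱbd (ψ j) i).1
  have hCR : ∀ i, dist (p.1 i) ℓ₀ ≤ R := by
    intro i
    refine le_of_tendsto' ((continuous_dist.continuousAt.tendsto).comp ((hClim i).prodMk_nhds
      (hrootlim.comp hψ.tendsto_atTop))) fun j => ?_
    exact hCbd (ψ j) i
  -- the sandwich, per hexagon
  have hsand : ∀ ε > (0 : ℝ), ∀ᶠ j in atTop, ∀ i, dist (Ck (ψ j) i) (p.1 i) < ε / 6 ∧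
      |ϱk (ψ j) i - p.2 i| < ε / 6 ∧ s (ψ j) < ε / 6 := by
    intro ε hε
    have h1 : ∀ i, ∀ᶠ j in atTop, dist (Ck (ψ j) i) (p.1 i) < ε / 6 := fun i =>
      (tendsto_iff_dist_tendsto_zero.1 (hClim i)).eventually (gt_mem_nhds (by positivity))
    have h2 : ∀ i, ∀ᶠ j in atTop, |ϱk (ψ j) i - p.2 i| < ε / 6 := fun i => by
      have := (tendsto_iff_dist_tendsto_zero.1 (hϱlim i)).eventually (gt_mem_nhds (by positivity : (0:ℝ) < ε / 6))
      exact this.mono fun j hj => by rwa [Real.dist_eq] at hj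
    have h3 : ∀ᶠ j in atTop, s (ψ j) < ε / 6 := (tendsto_order.1 hsψ).2 _ (by positivity)
    have h12 : ∀ᶠ j in atTop, ∀ i, dist (Ck (ψ j) i) (p.1 i) < ε / 6 ∧ |ϱk (ψ j) i - p.2 i| < ε / 6 := by
      rw [eventually_all]; exact fun i => (h1 i).and (h2 i)
    filter_upwards [h12, h3] with j hj hsj i
    exact ⟨(hj i).1, (hj i).2, hsj⟩
  -- containment
  have hcont : ∀ ε > (0 : ℝ), ∀ᶠ j in atTop, ∀ (i : Fin N), ∀ v ∈ hexBall (g (ψ j) i).1 (g (ψ j) i).2,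
      ∀ ℓ : Fin 3, |skewCoord ℓ ((s (ψ j) : ℂ) * hexCenter v - τ (ψ j) - p.1 i)| ≤ p.2 i + ε := by
    intro ε hε
    filter_upwards [hsand ε hε] with j hj i v hv ℓ
    rw [mem_hexBall_iff_hexCenter_mem_contHex (hspos (ψ j))] at hv
    have e : (s (ψ j) : ℂ) * hexCenter v = ((s (ψ j) : ℂ) * hexCenter v - τ (ψ j)) + τ (ψ j) := by ring
    rw [e] at hv
    have h0 := abs_le_of_pinned_mem_contHex (hspos (ψ j)) _ _ _ _ hv ℓ
    obtain ⟨hd, hr, hsj⟩ := hj i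
    have h1 := abs_skewCoord_sub_le_of_dist ℓ ((s (ψ j) : ℂ) * hexCenter v - τ (ψ j)) (Ck (ψ j) i) (p.1 i)
    rw [abs_lt] at hr
    change |skewCoord ℓ ((s (ψ j) : ℂ) * hexCenter v - τ (ψ j) - Ck (ψ j) i)| ≤ ϱk (ψ j) i + s (ψ j) / 6 at h0
    linarith
  refine ⟨ψ, p.1, p.2, hψ, hϱnn, hCR, hClim, hϱlim, ?_, hcont, ?_⟩
  · -- persistence
    intro ε hε
    filter_upwards [hsand ε hε] with j hj i v hv
    rw [mem_hexBall_iff_hexCenter_mem_contHex (hspos (ψ j))]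
    have e : (s (ψ j) : ℂ) * hexCenter v = ((s (ψ j) : ℂ) * hexCenter v - τ (ψ j)) + τ (ψ j) := by ring
    rw [e]
    refine pinned_mem_contHex_of_abs_le (hspos (ψ j)) _ _ _ _ fun ℓ => ?_
    obtain ⟨hd, hr, hsj⟩ := hj i
    have h1 := abs_skewCoord_sub_le_of_dist ℓ ((s (ψ j) : ℂ) * hexCenter v - τ (ψ j)) (p.1 i) (Ck (ψ j) i)
    rw [dist_comm] at hd
    have h2 := hv ℓ
    rw [abs_lt] at hr
    show |skewCoord ℓ ((s (ψ j) : ℂ) * hexCenter v - τ (ψ j) - Ck (ψ j) i)| ≤ ϱk (ψ j) i - s (ψ j) / 6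
    linarith
  · -- eventual carving of compacts
    intro K hK hdisj
    -- a common positive thickening missing `K`
    have hthick : ∀ i, ∃ ε > (0 : ℝ), Disjoint K {z : ℂ | ∀ ℓ : Fin 3, |skewCoord ℓ (z - p.1 i)| ≤ p.2 i + ε} := by
      intro i
      have hd := hdisj i
      rw [skewHexAbs_eq] at hd
      obtain ⟨ε, hε, hε'⟩ := exists_pos_disjoint_skewHex_thicken hK hd
      refine ⟨ε, hε, ?_⟩
      rw [skewHexAbs_eq]
      refine Set.disjoint_left.2 fun z hzK hz => Set.disjoint_left.1 hε' hzK fun ℓ => ?_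
      obtain ⟨h1, h2⟩ := hz ℓ
      constructor <;> linarith
    choose εi hεi hdisji using hthick
    rcases Nat.eq_zero_or_pos N with hN | hN
    · subst hN
      exact Eventually.of_forall fun j i => i.elim0
    · haveI : Nonempty (Fin N) := ⟨⟨0, hN⟩⟩
      set ε : ℝ := Finset.univ.inf' Finset.univ_nonempty εi with hεdef
      have hε : 0 < ε := by
        rw [hεdef, Finset.lt_inf'_iff]; exact fun i _ => hεi i
      have hεle : ∀ i, ε ≤ εi i := fun i => Finset.inf'_le _ (Finset.mem_univ i)
      filter_upwards [hcont ε hε] with j hj i v hi hvK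
      exact Set.disjoint_left.1 (hdisji i) hvK fun ℓ => (hj i v hi ℓ).trans (by linarith [hεle i])

end Summit.CriticalPhenomena.SAWScalingLimit.Theorems.ObservableToSLE.TypeLadder

end
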